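import Literature.AlgebraicGeometry.Frobenioids.ArithmeticFrobenioidThm64iii
import Literature.AlgebraicGeometry.Frobenioids.ArithmeticDivisorsPerfectionPrimes
import HarnessLib

/-!
# Frobenioids I, Theorem 6.4 (iii): the binders of `thm64iii_core` from the monoid isomorphism alone (PROOFS)

Mochizuki, *The geometry of Frobenioids I: the general theory*, Kyushu J. Math. **62** (2008) 293–400, §6,
Theorem 6.4 (iii) p. 114–116 [cite: MochizukiFrdI2008, Thm. 6.4 (iii) p.114]: "the bijection
`V(L₁) ⥲ Prime(Φ₁(L₁)) ⥲ Prime(Φ₂(L₂)) ⥲ V(L₂)` induced by `Ψ′` [cf. (i); Corollary 4.11, (iii)] maps a valuation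
lying over `v₀ ∈ V(ℚ)` to a valuation lying over `v₀`"; Thm. 6.4 (i) p. 115 l. 27–28 ("the homomorphism
`ArithDiv_ℝ(L) → ℝ` given by `deg_L^arith`").

abc-iut cell, sub-DAG `plan/L1/SUBDAG-FrdI-Thm64.md`, row T64iii — GLUE (ruling R111 (3)) of
`ArithmeticFrobenioidThm64iii.lean` (`thm64iii_core` / `thm64iii_of_divisorTransport`, seat abc-iut-L1-d9: the
numeric conclusion from a monoid isomorphism `θ : Φ₁(L₁)^pf ⥲ Φ₂(L₂)^pf`, a bijection of places `placeMap` with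
the RAY compatibility `hθπ`, degrees `d_i` on `Φ_i(L_i)^pf` extending `deg^arith` (`hd_i`) and the degree
compatibility `hθd`) with `exists_placesEquiv_of_mulEquiv` (`ArithmeticDivisorsPerfectionPrimes.lean`, seat
abc-iut-L6-t10: `θ` ALONE induces THE bijection `π : V(L₁) ≃ V(L₂)` with `Prime(θ)[δ_v] = [δ_{π v}]`):
* §1 `EffArithDivisor.precsim_single_iff_of_congr_eq` — the prime-class compatibility is equivalent data to the
  ray compatibility, so `placeMap`, `hθπ` are DISCHARGED from `θ`; `placeMap_eq_of_primeTransport` — and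
  `placeMap` is DETERMINED by `θ`;
* §2 `EffArithDivisor.exists_arithDegree_extension` / `arithDegree_extension_unique` — the degree `d_i` extending
  `deg^arith_{L_i}` to `Φ_i(L_i)^pf` EXISTS and is UNIQUE (`ℝ` is perfect), so `d_i`, `hd_i` are discharged;
* §3 `thm64iii_of_mulEquiv` — the numeric conclusion from `θ`, `deg > 0` and the degree compatibility alone;
* §4 `thm64iii_of_primeTransport` — the typed schema `Thm64iii` for the `θ`-induced `placeMap`; and
  `thm64iii_of_classMaps` — the same USING the schema's own hypothesis `Thm64iiDeg … deg` ((ii) applied on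
  divisors through THE class maps `cl_i : Φ_i(L_i)^pf → Pic_Φ(A_i)` with `δ ∘ cl_i = deg^arith` and
  `picMap ∘ cl₁ = cl₂ ∘ θ`), which DERIVES the degree compatibility `hθd`.
* §5 `thm64iii_of_divMulEquiv` / `thm64iii_of_divTransport` — the same from a DIVISOR-level isomorphism
  `e : Φ₁(L₁) ⥲ Φ₂(L₂)` (the shape of Cor. 4.11 (iii)'s `Ψ^Φ` at `Spec L₁`; `θ := Perfection.congr e`) with the
  divisor-level degree identity `deg^arith(e D) = deg · deg^arith(D)` — no perfection-level data at all.
What remains inline at THE constructions is `θ` itself with `picMap ∘ cl₁ = cl₂ ∘ θ` (Cor. 4.11 (iii) for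
`(Ψ^pf)^un-tr`, and "`Ψ^rlf` arises from `Ψ′`") and the class maps with their degrees (Thm. 6.4 (i)) — or, in
the §5 form, `e` and the degree identity.  Proof-only; nothing here is specific to abc.
-/

noncomputable section

namespace Literature.AlgebraicGeometry.Frobenioids

open NumberField Function

universe u v

/-! ### §1 Ray transport from prime transport -/

namespace EffArithDivisor

/-- **Ray transport from prime transport**: if `Prime(θ)` carries the prime `[δ_v]` of `Φ(L₁)^pf` to the prime
`[δ_{v'}]` of `Φ(L₂)^pf`, then `x ≼ [δ_v] ↔ θ x ≼ [δ_{v'}]` (`≼` is preserved and reflected by `θ`, and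
`θ[δ_v] ≼ [δ_{v'}] ≼ θ[δ_v]`). [cite: MochizukiFrdI2008, §0 p.12] -/
theorem precsim_single_iff_of_congr_eq {L₁ : Type} [Field L₁] [NumberField L₁] {L₂ : Type} [Field L₂]
    [NumberField L₂]
    (θ : Perfection (Multiplicative (EffArithDivisor L₁)) ≃* Perfection (Multiplicative (EffArithDivisor L₂)))
    {v : Places L₁} {v' : Places L₂}
    (h : Primes.congr θ (Quotient.mk (primarySetoid _) ⟨_, EffArithDivisor.isPrimary_of_single L₁ v⟩) =
      Quotient.mk (primarySetoid _) ⟨_, EffArithDivisor.isPrimary_of_single L₂ v'⟩)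
    (x : Perfection (Multiplicative (EffArithDivisor L₁))) :
    Precsim x (Perfection.of _ (Multiplicative.ofAdd (EffArithDivisor.single L₁ v))) ↔
      Precsim (θ x) (Perfection.of _ (Multiplicative.ofAdd (EffArithDivisor.single L₂ v'))) := by
  rw [Primes.congr_mk θ _ _ ((EffArithDivisor.isPrimary_of_single L₁ v).map_mulEquiv θ)] at h
  have h₁ : Precsim (θ (Perfection.of _ (Multiplicative.ofAdd (EffArithDivisor.single L₁ v))))
      (Perfection.of _ (Multiplicative.ofAdd (EffArithDivisor.single L₂ v'))) := Quotient.exact h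
  have h₂ : Precsim (Perfection.of _ (Multiplicative.ofAdd (EffArithDivisor.single L₂ v')))
      (θ (Perfection.of _ (Multiplicative.ofAdd (EffArithDivisor.single L₁ v)))) := Quotient.exact h.symm
  exact ⟨fun hx => ((precsim_map_iff θ).mpr hx).trans h₁, fun hx => (precsim_map_iff θ).mp (hx.trans h₂)⟩

end EffArithDivisor

/-! ### §2 The degree extending `deg^arith` to `Φ(L)^pf` exists and is unique -/

/-- `ℝ` (written multiplicatively) is perfect: multiplication by `n ≥ 1` is bijective. [cite: MochizukiFrdI2008, §0 p.11] -/
theorem isPerfect_multiplicative_real : IsPerfect (Multiplicative ℝ) := by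
  refine ⟨fun n hn => ?_⟩
  have hn' : (n : ℝ) ≠ 0 := Nat.cast_ne_zero.mpr hn.ne'
  constructor
  · intro x y hxy
    have h : n • Multiplicative.toAdd x = n • Multiplicative.toAdd y := by
      rw [← toAdd_pow, ← toAdd_pow]; exact congrArg _ hxy
    rw [nsmul_eq_mul, nsmul_eq_mul] at h
    exact Multiplicative.toAdd.injective (mul_left_cancel₀ hn' h)
  · intro y
    refine ⟨Multiplicative.ofAdd (Multiplicative.toAdd y / n), ?_⟩
    dsimp only
    rw [← ofAdd_nsmul, nsmul_eq_mul, mul_div_cancel₀ _ hn', ofAdd_toAdd]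

namespace EffArithDivisor

/-- **The arithmetic degree extends to `Φ(L)^pf`**: there is a homomorphism `d : Φ(L)^pf → ℝ` with
`d([D]) = deg^arith(D)` (`ℝ` is perfect: `d = (ℝ ≅ ℝ^pf)⁻¹ ∘ (deg^arith)^pf`, `D^{1/n} ↦ deg^arith(D)/n`).
[cite: MochizukiFrdI2008, Thm. 6.4 (i) p.115] -/
theorem exists_arithDegree_extension (L : Type) [Field L] [NumberField L] :
    ∃ d : Perfection (Multiplicative (EffArithDivisor L)) →* Multiplicative ℝ,
      ∀ D : EffArithDivisor L,
        Multiplicative.toAdd (d (Perfection.of _ (Multiplicative.ofAdd D))) = arithDegree L (toArithDivisor L D) := by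
  let δ : Multiplicative (EffArithDivisor L) →* Multiplicative ℝ :=
    ((arithDegree L).comp (toArithDivisor L)).toMultiplicative
  let e : Multiplicative ℝ ≃* Perfection (Multiplicative ℝ) :=
    MulEquiv.ofBijective (Perfection.of _) (isPerfect_iff_bijective_of.mp isPerfect_multiplicative_real)
  refine ⟨e.symm.toMonoidHom.comp (Perfection.map δ), fun D => ?_⟩
  have h1 : Perfection.map δ (Perfection.of _ (Multiplicative.ofAdd D)) =
      Perfection.of _ (δ (Multiplicative.ofAdd D)) := by
    rw [← MonoidHom.comp_apply, Perfection.map_comp_of]; rfl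
  rw [MonoidHom.comp_apply, h1]
  change Multiplicative.toAdd (e.symm (e (δ (Multiplicative.ofAdd D)))) = _
  rw [e.symm_apply_apply]
  rfl

/-- **… uniquely**: two homomorphisms `Φ(L)^pf → ℝ` extending `deg^arith` coincide (both are `deg^arith(D)/n` on
`D^{1/n}`). [cite: MochizukiFrdI2008, Thm. 6.4 (i) p.115] -/
theorem arithDegree_extension_unique {L : Type} [Field L] [NumberField L]
    {d d' : Perfection (Multiplicative (EffArithDivisor L)) →* Multiplicative ℝ}
    (hd : ∀ D : EffArithDivisor L,
      Multiplicative.toAdd (d (Perfection.of _ (Multiplicative.ofAdd D))) = arithDegree L (toArithDivisor L D))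
    (hd' : ∀ D : EffArithDivisor L,
      Multiplicative.toAdd (d' (Perfection.of _ (Multiplicative.ofAdd D))) = arithDegree L (toArithDivisor L D)) :
    d = d' := by
  refine MonoidHom.ext fun b => ?_
  obtain ⟨⟨x, n⟩, rfl⟩ := Perfection.mk_surjective b
  obtain ⟨D, rfl⟩ := Multiplicative.ofAdd.surjective x
  change d (Perfection.mk (Multiplicative.ofAdd D) n) = d' (Perfection.mk (Multiplicative.ofAdd D) n)
  apply Multiplicative.toAdd.injective
  rw [toAdd_apply_mk_eq d hd, toAdd_apply_mk_eq d' hd']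

end EffArithDivisor

/-! ### §3 The numeric conclusion from `θ` and the degree compatibility -/

open EffArithDivisor

/-- **Theorem 6.4 (iii), numeric conclusion from `θ` and the degree compatibility alone**: the monoid
isomorphism `θ : Φ₁(L₁)^pf ⥲ Φ₂(L₂)^pf` induces THE bijection of places `π` (`Prime(θ)[δ_v] = [δ_{π v}]`,
`exists_placesEquiv_of_mulEquiv`), and for it: `deg ∈ ℚ_{>0}`, archimedean ↦ archimedean, finite ↦ finite of the
same residue characteristic. [cite: MochizukiFrdI2008, Thm. 6.4 (iii) p.114] -/
theorem thm64iii_of_mulEquiv (L₁ : Type) [Field L₁] [NumberField L₁] (L₂ : Type) [Field L₂] [NumberField L₂]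
    (deg : ℝ) (hdeg : 0 < deg)
    (θ : Perfection (Multiplicative (EffArithDivisor L₁)) ≃* Perfection (Multiplicative (EffArithDivisor L₂)))
    (d₁ : Perfection (Multiplicative (EffArithDivisor L₁)) →* Multiplicative ℝ)
    (d₂ : Perfection (Multiplicative (EffArithDivisor L₂)) →* Multiplicative ℝ)
    (hd₁ : ∀ D, Multiplicative.toAdd (d₁ (Perfection.of _ (Multiplicative.ofAdd D))) = arithDegree L₁ (toArithDivisor L₁ D))
    (hd₂ : ∀ D, Multiplicative.toAdd (d₂ (Perfection.of _ (Multiplicative.ofAdd D))) = arithDegree L₂ (toArithDivisor L₂ D))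
    (hθd : ∀ x, Multiplicative.toAdd (d₂ (θ x)) = deg * Multiplicative.toAdd (d₁ x)) :
    ∃ π : Places L₁ ≃ Places L₂,
      (∀ v : Places L₁,
          Primes.congr θ (Quotient.mk (primarySetoid _) ⟨_, EffArithDivisor.isPrimary_of_single L₁ v⟩) =
            Quotient.mk (primarySetoid _) ⟨_, EffArithDivisor.isPrimary_of_single L₂ (π v)⟩) ∧
      (∃ q : ℚ, 0 < q ∧ deg = q) ∧
      (∀ u : InfinitePlace L₁, ∃ u' : InfinitePlace L₂, π (Sum.inl u) = Sum.inl u') ∧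
      ∀ w : FinitePlace L₁, ∃ w' : FinitePlace L₂, π (Sum.inr w) = Sum.inr w' ∧ residueChar w = residueChar w' := by
  obtain ⟨π, hπ, -, -⟩ := exists_placesEquiv_of_mulEquiv L₁ L₂ θ
  exact ⟨π, hπ, thm64iii_core L₁ L₂ deg hdeg π θ
    (fun v x => EffArithDivisor.precsim_single_iff_of_congr_eq θ (hπ v) x) d₁ d₂ hd₁ hd₂ hθd⟩

/-- **THE bijection of places is determined by `θ`**: any `placeMap` compatible with `θ` on primes is the one of
`exists_placesEquiv_of_mulEquiv` (the map `v ↦ [δ_v]` is injective, Ex. 6.3). [cite: MochizukiFrdI2008, Ex. 6.3 p.113] -/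
theorem placeMap_eq_of_primeTransport (L₁ : Type) [Field L₁] [NumberField L₁] (L₂ : Type) [Field L₂] [NumberField L₂]
    (θ : Perfection (Multiplicative (EffArithDivisor L₁)) ≃* Perfection (Multiplicative (EffArithDivisor L₂)))
    (π π' : Places L₁ ≃ Places L₂)
    (hπ : ∀ v : Places L₁,
      Primes.congr θ (Quotient.mk (primarySetoid _) ⟨_, EffArithDivisor.isPrimary_of_single L₁ v⟩) =
        Quotient.mk (primarySetoid _) ⟨_, EffArithDivisor.isPrimary_of_single L₂ (π v)⟩)
    (hπ' : ∀ v : Places L₁,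
      Primes.congr θ (Quotient.mk (primarySetoid _) ⟨_, EffArithDivisor.isPrimary_of_single L₁ v⟩) =
        Quotient.mk (primarySetoid _) ⟨_, EffArithDivisor.isPrimary_of_single L₂ (π' v)⟩) :
    π = π' :=
  Equiv.ext fun v => (EffArithDivisor.pfPrimeOf_bijective L₂).1 ((hπ v).symm.trans (hπ' v))

/-! ### §4 The typed schema from prime transport -/

variable {F₁ : Type} [Field F₁] [NumberField F₁] {K₁ : Type} [Field K₁] [Algebra F₁ K₁]
variable {F₂ : Type} [Field F₂] [NumberField F₂] {K₂ : Type} [Field K₂] [Algebra F₂ K₂]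
variable {Rlf₁ : Type u} [CategoryTheory.Category.{v} Rlf₁] {Rlf₂ : Type u} [CategoryTheory.Category.{v} Rlf₂]
variable (R₁ : ArithRealification (F := F₁) (K := K₁) Rlf₁) (R₂ : ArithRealification (F := F₂) (K := K₂) Rlf₂)

/-- **Theorem 6.4 (iii) AS TYPED (`Thm64iii`) from `θ` with prime compatibility and the degree compatibility**:
the schema holds for the bijection of places `placeMap` INDUCED by `θ` on primes (`Prime(θ)[δ_v] = [δ_{placeMap v}]`
— Cor. 4.11 (iii)'s compatibility with `Ψ^Prime`, the bijection "induced by `Ψ′`" of print), given the degree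
compatibility `hθd` (Thm. 6.4 (ii)). [cite: MochizukiFrdI2008, Thm. 6.4 (iii) p.114] -/
theorem thm64iii_of_primeTransport (Ψ : Rlf₁ ≌ Rlf₂)
    (picMap : ∀ A : Rlf₁, R₁.Pic A ≃+ R₂.Pic (Ψ.functor.obj A)) (deg : ℝ)
    {U₁ : Type u} [CategoryTheory.Category.{v} U₁] {U₂ : Type u} [CategoryTheory.Category.{v} U₂]
    (u₁ : CategoryTheory.Functor U₁ Rlf₁) (u₂ : CategoryTheory.Functor U₂ Rlf₂) (Ψ' : U₁ ≌ U₂) (A₁ : U₁)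
    (placeMap : Places (R₁.ops.base.obj (u₁.obj A₁)).L ≃
      Places (R₂.ops.base.obj (u₂.obj (Ψ'.functor.obj A₁))).L)
    (θ : Perfection (Multiplicative (EffArithDivisor (R₁.ops.base.obj (u₁.obj A₁)).L)) ≃*
      Perfection (Multiplicative (EffArithDivisor (R₂.ops.base.obj (u₂.obj (Ψ'.functor.obj A₁))).L)))
    (hθ : ∀ v : Places (R₁.ops.base.obj (u₁.obj A₁)).L,
      Primes.congr θ (Quotient.mk (primarySetoid _) ⟨_, EffArithDivisor.isPrimary_of_single _ v⟩) =
        Quotient.mk (primarySetoid _) ⟨_, EffArithDivisor.isPrimary_of_single _ (placeMap v)⟩)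
    (d₁ : Perfection (Multiplicative (EffArithDivisor (R₁.ops.base.obj (u₁.obj A₁)).L)) →* Multiplicative ℝ)
    (d₂ : Perfection (Multiplicative (EffArithDivisor (R₂.ops.base.obj (u₂.obj (Ψ'.functor.obj A₁))).L)) →*
      Multiplicative ℝ)
    (hd₁ : ∀ D, Multiplicative.toAdd (d₁ (Perfection.of _ (Multiplicative.ofAdd D))) = arithDegree _ (toArithDivisor _ D))
    (hd₂ : ∀ D, Multiplicative.toAdd (d₂ (Perfection.of _ (Multiplicative.ofAdd D))) = arithDegree _ (toArithDivisor _ D))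
    (hθd : ∀ x, Multiplicative.toAdd (d₂ (θ x)) = deg * Multiplicative.toAdd (d₁ x)) :
    Thm64iii R₁ R₂ Ψ picMap deg u₁ u₂ Ψ' A₁ placeMap :=
  thm64iii_of_divisorTransport R₁ R₂ Ψ picMap deg u₁ u₂ Ψ' A₁ placeMap θ
    (fun v x => EffArithDivisor.precsim_single_iff_of_congr_eq θ (hθ v) x) d₁ d₂ hd₁ hd₂ hθd


/-- **Theorem 6.4 (iii) AS TYPED (`Thm64iii`) USING the degree relation `Thm64iiDeg` of (ii)** (row T64iii/L03 as
print has it: "(ii) applied to the generator class"): given `θ` with prime compatibility (THE induced `placeMap`),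
THE class maps `cl_i : Φ_i(L_i)^pf → Pic_Φ(A_i)` (`D ↦` the class of `O(D)`, through `Φ_i^rlf(A_i)`; `A₁ = u₁ A₁'`
Frobenius-trivial, `A₂ = Ψ^rlf A₁`) whose `δ_{A_i}`-degree is `deg^arith_{L_i}` (Thm. 6.4 (i): `δ_A` is induced by
`deg^arith`), and the compatibility `picMap ∘ cl₁ = cl₂ ∘ θ` ("`Ψ^rlf` arises from `Ψ′`", read on divisors), the
hypothesis `Thm64iiDeg … deg` of the schema yields the degree compatibility `hθd`, whence the conclusion.
[cite: MochizukiFrdI2008, Thm. 6.4 (iii) p.116] -/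
theorem thm64iii_of_classMaps (Ψ : Rlf₁ ≌ Rlf₂)
    (picMap : ∀ A : Rlf₁, R₁.Pic A ≃+ R₂.Pic (Ψ.functor.obj A)) (deg : ℝ)
    {U₁ : Type u} [CategoryTheory.Category.{v} U₁] {U₂ : Type u} [CategoryTheory.Category.{v} U₂]
    (u₁ : CategoryTheory.Functor U₁ Rlf₁) (u₂ : CategoryTheory.Functor U₂ Rlf₂) (Ψ' : U₁ ≌ U₂) (A₁ : U₁)
    (placeMap : Places (R₁.ops.base.obj (u₁.obj A₁)).L ≃
      Places (R₂.ops.base.obj (u₂.obj (Ψ'.functor.obj A₁))).L)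
    (θ : Perfection (Multiplicative (EffArithDivisor (R₁.ops.base.obj (u₁.obj A₁)).L)) ≃*
      Perfection (Multiplicative (EffArithDivisor (R₂.ops.base.obj (u₂.obj (Ψ'.functor.obj A₁))).L)))
    (hθ : ∀ v : Places (R₁.ops.base.obj (u₁.obj A₁)).L,
      Primes.congr θ (Quotient.mk (primarySetoid _) ⟨_, EffArithDivisor.isPrimary_of_single _ v⟩) =
        Quotient.mk (primarySetoid _) ⟨_, EffArithDivisor.isPrimary_of_single _ (placeMap v)⟩)
    (hA : R₁.ops.IsFrobeniusTrivial (u₁.obj A₁)) (hA' : R₂.ops.IsFrobeniusTrivial (Ψ.functor.obj (u₁.obj A₁)))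
    (cl₁ : Perfection (Multiplicative (EffArithDivisor (R₁.ops.base.obj (u₁.obj A₁)).L)) →*
      Multiplicative (R₁.Pic (u₁.obj A₁)))
    (cl₂ : Perfection (Multiplicative (EffArithDivisor (R₂.ops.base.obj (u₂.obj (Ψ'.functor.obj A₁))).L)) →*
      Multiplicative (R₂.Pic (Ψ.functor.obj (u₁.obj A₁))))
    (hcl₁ : ∀ D, R₁.δ _ hA (Multiplicative.toAdd (cl₁ (Perfection.of _ (Multiplicative.ofAdd D)))) =
      arithDegree _ (toArithDivisor _ D))
    (hcl₂ : ∀ D, R₂.δ _ hA' (Multiplicative.toAdd (cl₂ (Perfection.of _ (Multiplicative.ofAdd D)))) =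
      arithDegree _ (toArithDivisor _ D))
    (hθcl : ∀ x, picMap _ (Multiplicative.toAdd (cl₁ x)) = Multiplicative.toAdd (cl₂ (θ x))) :
    Thm64iii R₁ R₂ Ψ picMap deg u₁ u₂ Ψ' A₁ placeMap := by
  intro hT h1
  refine thm64iii_of_primeTransport R₁ R₂ Ψ picMap deg u₁ u₂ Ψ' A₁ placeMap θ hθ
    ((R₁.δ _ hA).toAddMonoidHom.toMultiplicative.comp cl₁) ((R₂.δ _ hA').toAddMonoidHom.toMultiplicative.comp cl₂)
    (fun D => hcl₁ D) (fun D => hcl₂ D) (fun x => ?_) hT h1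
  change R₂.δ _ hA' (Multiplicative.toAdd (cl₂ (θ x))) = deg * R₁.δ _ hA (Multiplicative.toAdd (cl₁ x))
  rw [← hθcl, hT.2]

/-! ### §5 From a DIVISOR-level isomorphism `e : Φ₁(L₁) ⥲ Φ₂(L₂)` (the shape of Cor. 4.11 (iii)'s `Ψ^Φ`)

Cor. 4.11 (iii) (tree: `DivisorMonoidIsoOverBase`, components `E'.iso X : Φ₁(X) ≃* Φ₂(Ψ^Base X)`, seat
abc-iut-L1-t14) delivers the transport on the DIVISOR MONOIDS; `θ := Perfection.congr e` is then the transport on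
the perfections, its prime compatibility reads "`e(δ_v)` is supported exactly at `π v`", and its degree
compatibility is the divisor-level identity `deg^arith(e D) = deg · deg^arith(D)`.  So the consumer at THE data
(row T64iii/θ-SUPPLY) needs only `e` and that identity. -/

namespace Perfection

/-- Two homomorphisms `M^pf → ℝ` that agree on `M` coincide (`n`-th roots are unique in `(ℝ, +)`).
[cite: MochizukiFrdI2008, §0 p.11] -/
theorem hom_real_ext_of {M : Type} [CommMonoid M] {ψ ψ' : Perfection M →* Multiplicative ℝ}
    (h : ∀ a : M, ψ (Perfection.of M a) = ψ' (Perfection.of M a)) : ψ = ψ' := by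
  refine MonoidHom.ext fun b => ?_
  obtain ⟨⟨a, n⟩, rfl⟩ := Perfection.mk_surjective b
  change ψ (Perfection.mk a n) = ψ' (Perfection.mk a n)
  have key : ψ (Perfection.mk a n) ^ (n : ℕ) = ψ' (Perfection.mk a n) ^ (n : ℕ) := by
    rw [← map_pow, ← map_pow, Perfection.mk_pow_self]
    exact h a
  have key' := congrArg Multiplicative.toAdd key
  rw [toAdd_pow, toAdd_pow] at key'
  exact Multiplicative.toAdd.injective (nsmul_right_injective n.ne_zero key')

end Perfection

namespace EffArithDivisor

/-- **Prime compatibility of `Perfection.congr e` = support transport of `e`**: `Prime(e^pf)[δ_v] = [δ_{v'}]` iff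
`e(δ_v)` is supported exactly at `v'` (Ex. 6.3: `≼`-classes of `Φ(L)` are classified by supports).
[cite: MochizukiFrdI2008, Ex. 6.3 p.113] -/
theorem congr_perfectionCongr_mk_single_eq_iff {L₁ : Type} [Field L₁] [NumberField L₁] {L₂ : Type} [Field L₂]
    [NumberField L₂] (e : Multiplicative (EffArithDivisor L₁) ≃* Multiplicative (EffArithDivisor L₂))
    (v : Places L₁) (v' : Places L₂) :
    Primes.congr (Perfection.congr e)
          (Quotient.mk (primarySetoid _) ⟨_, EffArithDivisor.isPrimary_of_single L₁ v⟩) =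
        Quotient.mk (primarySetoid _) ⟨_, EffArithDivisor.isPrimary_of_single L₂ v'⟩ ↔
      psupp (Multiplicative.toAdd (e (Multiplicative.ofAdd (EffArithDivisor.single L₁ v)))) = {v'} := by
  -- `Perfection.congr e (of a) = of (e a)` definitionally (`Perfection.congr_of`)
  rw [Primes.congr_mk (Perfection.congr e) _ _
    ((EffArithDivisor.isPrimary_of_single L₁ v).map_mulEquiv (Perfection.congr e))]
  have key : Precsim (Perfection.of _ (e (Multiplicative.ofAdd (EffArithDivisor.single L₁ v))))
        (Perfection.of _ (Multiplicative.ofAdd (EffArithDivisor.single L₂ v'))) ↔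
      psupp (Multiplicative.toAdd (e (Multiplicative.ofAdd (EffArithDivisor.single L₁ v)))) ⊆ {v'} := by
    rw [Perfection.of_precsim_of_iff, ← ofAdd_toAdd (e _), precsim_iff_psupp_subset, psupp_single, toAdd_ofAdd]
  have key' : Precsim (Perfection.of _ (Multiplicative.ofAdd (EffArithDivisor.single L₂ v')))
        (Perfection.of _ (e (Multiplicative.ofAdd (EffArithDivisor.single L₁ v)))) ↔
      {v'} ⊆ psupp (Multiplicative.toAdd (e (Multiplicative.ofAdd (EffArithDivisor.single L₁ v)))) := by
    rw [Perfection.of_precsim_of_iff, ← ofAdd_toAdd (e _), precsim_iff_psupp_subset, psupp_single, toAdd_ofAdd]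
  constructor
  · intro h
    have h₁ : Precsim (Perfection.of _ (e (Multiplicative.ofAdd (EffArithDivisor.single L₁ v))))
        (Perfection.of _ (Multiplicative.ofAdd (EffArithDivisor.single L₂ v'))) := Quotient.exact h
    have h₂ : Precsim (Perfection.of _ (Multiplicative.ofAdd (EffArithDivisor.single L₂ v')))
        (Perfection.of _ (e (Multiplicative.ofAdd (EffArithDivisor.single L₁ v)))) := Quotient.exact h.symm
    exact Set.Subset.antisymm (key.mp h₁) (key'.mp h₂)
  · intro h
    refine Quotient.sound ?_
    change Precsim (Perfection.of _ (e (Multiplicative.ofAdd (EffArithDivisor.single L₁ v))))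
      (Perfection.of _ (Multiplicative.ofAdd (EffArithDivisor.single L₂ v')))
    exact key.mpr h.le

/-- **Degree compatibility of `Perfection.congr e` from the divisor-level identity**: if
`deg^arith(e D) = deg · deg^arith(D)` on `Φ₁(L₁)`, then the (unique) degrees `d_i` on `Φ_i(L_i)^pf` extending
`deg^arith` satisfy `d₂(e^pf x) = deg · d₁(x)`. [cite: MochizukiFrdI2008, Thm. 6.4 (iii) p.116] -/
theorem exists_degrees_of_divMulEquiv {L₁ : Type} [Field L₁] [NumberField L₁] {L₂ : Type} [Field L₂]
    [NumberField L₂] (e : Multiplicative (EffArithDivisor L₁) ≃* Multiplicative (EffArithDivisor L₂)) (deg : ℝ)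
    (hed : ∀ D : EffArithDivisor L₁,
      arithDegree L₂ (toArithDivisor L₂ (Multiplicative.toAdd (e (Multiplicative.ofAdd D)))) =
        deg * arithDegree L₁ (toArithDivisor L₁ D)) :
    ∃ (d₁ : Perfection (Multiplicative (EffArithDivisor L₁)) →* Multiplicative ℝ)
      (d₂ : Perfection (Multiplicative (EffArithDivisor L₂)) →* Multiplicative ℝ),
      (∀ D, Multiplicative.toAdd (d₁ (Perfection.of _ (Multiplicative.ofAdd D))) = arithDegree L₁ (toArithDivisor L₁ D)) ∧
      (∀ D, Multiplicative.toAdd (d₂ (Perfection.of _ (Multiplicative.ofAdd D))) = arithDegree L₂ (toArithDivisor L₂ D)) ∧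
      ∀ x, Multiplicative.toAdd (d₂ (Perfection.congr e x)) = deg * Multiplicative.toAdd (d₁ x) := by
  obtain ⟨d₁, hd₁⟩ := exists_arithDegree_extension L₁
  obtain ⟨d₂, hd₂⟩ := exists_arithDegree_extension L₂
  refine ⟨d₁, d₂, hd₁, hd₂, fun x => ?_⟩
  -- both `d₂ ∘ e^pf` and `(deg · −) ∘ d₁` extend `D ↦ deg · deg^arith(D)`
  have key : d₂.comp (Perfection.congr e).toMonoidHom =
      (AddMonoidHom.mulLeft deg).toMultiplicative.comp d₁ := by
    refine Perfection.hom_real_ext_of fun a => ?_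
    obtain ⟨D, rfl⟩ := Multiplicative.ofAdd.surjective a
    apply Multiplicative.toAdd.injective
    -- `Perfection.congr e (of a) = of (e a)` definitionally (`Perfection.congr_of`)
    change Multiplicative.toAdd (d₂ (Perfection.of _ (e (Multiplicative.ofAdd D)))) =
      deg * Multiplicative.toAdd (d₁ (Perfection.of _ (Multiplicative.ofAdd D)))
    rw [hd₁, ← hed D, ← hd₂, ofAdd_toAdd]
  have := DFunLike.congr_fun key x
  exact congrArg Multiplicative.toAdd this

end EffArithDivisor

/-- **Theorem 6.4 (iii), numeric conclusion from a DIVISOR-level isomorphism**: for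
`e : Φ₁(L₁) ⥲ Φ₂(L₂)` with `deg^arith(e D) = deg · deg^arith(D)`, `deg > 0`, there is THE bijection of places `π`
("`e(δ_v)` is supported exactly at `π v`") with `deg ∈ ℚ_{>0}`, archimedean ↦ archimedean, finite ↦ finite of the
same residue characteristic. [cite: MochizukiFrdI2008, Thm. 6.4 (iii) p.114] -/
theorem thm64iii_of_divMulEquiv (L₁ : Type) [Field L₁] [NumberField L₁] (L₂ : Type) [Field L₂] [NumberField L₂]
    (deg : ℝ) (hdeg : 0 < deg)
    (e : Multiplicative (EffArithDivisor L₁) ≃* Multiplicative (EffArithDivisor L₂))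
    (hed : ∀ D : EffArithDivisor L₁,
      arithDegree L₂ (toArithDivisor L₂ (Multiplicative.toAdd (e (Multiplicative.ofAdd D)))) =
        deg * arithDegree L₁ (toArithDivisor L₁ D)) :
    ∃ π : Places L₁ ≃ Places L₂,
      (∀ v : Places L₁,
          psupp (Multiplicative.toAdd (e (Multiplicative.ofAdd (EffArithDivisor.single L₁ v)))) = {π v}) ∧
      (∃ q : ℚ, 0 < q ∧ deg = q) ∧
      (∀ u : InfinitePlace L₁, ∃ u' : InfinitePlace L₂, π (Sum.inl u) = Sum.inl u') ∧
      ∀ w : FinitePlace L₁, ∃ w' : FinitePlace L₂, π (Sum.inr w) = Sum.inr w' ∧ residueChar w = residueChar w' := by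
  obtain ⟨d₁, d₂, hd₁, hd₂, hθd⟩ := EffArithDivisor.exists_degrees_of_divMulEquiv e deg hed
  obtain ⟨π, hπ, h⟩ := thm64iii_of_mulEquiv L₁ L₂ deg hdeg (Perfection.congr e) d₁ d₂ hd₁ hd₂ hθd
  exact ⟨π, fun v => (EffArithDivisor.congr_perfectionCongr_mk_single_eq_iff e v (π v)).mp (hπ v), h⟩

/-- **Theorem 6.4 (iii) AS TYPED (`Thm64iii`) from a DIVISOR-level isomorphism** `e : Φ₁(L₁) ⥲ Φ₂(L₂)` carrying
`δ_v` to a divisor supported at `placeMap v` and satisfying `deg^arith(e D) = deg · deg^arith(D)` — the shape in which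
Cor. 4.11 (iii) (`Ψ^Φ` at `Spec L₁`) and Thm. 6.4 (ii) (on divisors) arrive at THE constructions.
[cite: MochizukiFrdI2008, Thm. 6.4 (iii) p.114] -/
theorem thm64iii_of_divTransport (Ψ : Rlf₁ ≌ Rlf₂)
    (picMap : ∀ A : Rlf₁, R₁.Pic A ≃+ R₂.Pic (Ψ.functor.obj A)) (deg : ℝ)
    {U₁ : Type u} [CategoryTheory.Category.{v} U₁] {U₂ : Type u} [CategoryTheory.Category.{v} U₂]
    (u₁ : CategoryTheory.Functor U₁ Rlf₁) (u₂ : CategoryTheory.Functor U₂ Rlf₂) (Ψ' : U₁ ≌ U₂) (A₁ : U₁)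
    (placeMap : Places (R₁.ops.base.obj (u₁.obj A₁)).L ≃
      Places (R₂.ops.base.obj (u₂.obj (Ψ'.functor.obj A₁))).L)
    (e : Multiplicative (EffArithDivisor (R₁.ops.base.obj (u₁.obj A₁)).L) ≃*
      Multiplicative (EffArithDivisor (R₂.ops.base.obj (u₂.obj (Ψ'.functor.obj A₁))).L))
    (he : ∀ v : Places (R₁.ops.base.obj (u₁.obj A₁)).L,
      psupp (Multiplicative.toAdd (e (Multiplicative.ofAdd (EffArithDivisor.single _ v)))) = {placeMap v})
    (hed : ∀ D,
      arithDegree _ (toArithDivisor _ (Multiplicative.toAdd (e (Multiplicative.ofAdd D)))) =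
        deg * arithDegree _ (toArithDivisor _ D)) :
    Thm64iii R₁ R₂ Ψ picMap deg u₁ u₂ Ψ' A₁ placeMap := by
  obtain ⟨d₁, d₂, hd₁, hd₂, hθd⟩ := EffArithDivisor.exists_degrees_of_divMulEquiv e deg hed
  exact thm64iii_of_primeTransport R₁ R₂ Ψ picMap deg u₁ u₂ Ψ' A₁ placeMap (Perfection.congr e)
    (fun v => (EffArithDivisor.congr_perfectionCongr_mk_single_eq_iff e v (placeMap v)).mpr (he v))
    d₁ d₂ hd₁ hd₂ hθd

end Literature.AlgebraicGeometry.Frobenioids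

end
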